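import Summits.SmoothPoincare4.SmoothPoincare4.Theorems.SullivanDualTargetOfSympcap
import Literature.Geometry.Symplectic.GromovR4StdModel
import Mathlib.Analysis.Calculus.MeanValue
import Mathlib.Analysis.InnerProductSpace.Calculus
import Mathlib.Analysis.SpecialFunctions.Trigonometric.Deriv
import Mathlib.Topology.UniformSpace.HeineCantor

/-!
# SmoothPoincare4 / SullivanDual — crux `Target` (stmt-SmoothPoincare4-7823), line kaehler-jacket,
stub `helper_collarFirstOrder`

First-order data at the unit sphere `S³ ⊂ ℝ⁴` of a *collar map*: a map `κ : ℝ⁴ → ℝ⁴` which is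
`C^∞` with injective differential on the open shell `{y | |‖y‖ - 1| < δ₁}`, restricts to the
identity on the unit sphere, and maps the inner side of the shell to the inner side of the sphere
(`‖y‖ < 1 ↔ ‖κ y‖ < 1`).  We prove (`helper_collarFirstOrder`):

* the differential at a unit vector `θ` fixes `θ^⊥` (differentiate `κ ∘ γ = γ` along the great
  circle `γ t = cos t • θ + sin t • u`, `u ⊥ θ`);
* the radial stretch `g θ = ⟨dκ(θ) θ, θ⟩` is nonnegative (the function `r ↦ ‖κ (r • θ)‖²` is
  `< 1` to the left of `r = 1` and `= 1` at `r = 1`, so its derivative `2 g θ` at `1` is `≥ 0`)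
  and in fact positive (if `g θ = 0` then `w = dκ(θ) θ ⊥ θ` is fixed by `dκ(θ)`, so
  `dκ(θ) (θ - w) = 0` with `θ - w ≠ 0`, contradicting injectivity); by compactness of the sphere
  and continuity of `dκ` it is bounded below by some `m > 0`, and `‖dκ(θ)‖ ≤ W` uniformly;
* `dκ` is uniformly continuous on the compact shell `{y | |‖y‖ - 1| ≤ δ₁ / 2}` (Heine–Cantor),
  which gives, for every `ε > 0`, a `δ ∈ (0, δ₁)` with `‖dκ(r • θ) - dκ(θ)‖ ≤ ε` for
  `|r - 1| < δ`, and then the first-order Taylor remainder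
  `‖κ (r • θ) - r • θ - (r - 1) • (dκ(θ) θ - θ)‖ ≤ ε |r - 1|` by the mean value inequality
  along the radial segment.

All of this is elementary multivariable calculus. [folklore]
-/

noncomputable section

set_option linter.dupNamespace false

open scoped Manifold ContDiff Topology
open Set Function
open Literature.Geometry.Kaehler (MForm IsSmoothForm IsClosedForm mextDeriv)
open Literature.Geometry.Symplectic (punctured InPuncturedChartBall stdSymplecticForm inversion
  invertedStdForm IsSymplecticStandardNearPoint AgreesWithInvertedChartNear)
open Literature.Topology.FourManifolds (HomotopySphere)

namespace Summit.SmoothPoincare4.SmoothPoincare4.Theorems.Target.KaehlerJacket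

local notation "E4" => EuclideanSpace ℝ (Fin 4)

/-- For a unit vector `θ` and `|r - 1| < 1` we have `‖r • θ‖ = r`. [folklore] -/
theorem collarFirstOrder_norm_radial_smul {θ : E4} (hθ : ‖θ‖ = 1) {r : ℝ} (hr : |r - 1| < 1) :
    ‖r • θ‖ = r := by
  have hr0 : 0 ≤ r := by
    have := (abs_lt.mp hr).1
    linarith
  rw [norm_smul, hθ, mul_one, Real.norm_eq_abs, abs_of_nonneg hr0]

/-- A map equal to the identity on the unit sphere and differentiable at a unit vector `θ` has
differential fixing every vector orthogonal to `θ`: differentiate `κ ∘ γ = γ` along the great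
circle `γ t = cos t • θ + sin t • u`. [folklore] -/
theorem collarFirstOrder_fderiv_apply_of_orthogonal {κ : E4 → E4}
    (hsphere : ∀ y : E4, ‖y‖ = 1 → κ y = y) {θ : E4} (hθ : ‖θ‖ = 1)
    (hdiff : DifferentiableAt ℝ κ θ) {v : E4} (hv : inner ℝ v θ = 0) :
    fderiv ℝ κ θ v = v := by
  -- reduce to a unit vector `u`
  suffices key : ∀ u : E4, ‖u‖ = 1 → inner ℝ u θ = 0 → fderiv ℝ κ θ u = u by
    by_cases hv0 : v = 0
    · simp [hv0]
    have hvn : ‖v‖ ≠ 0 := norm_ne_zero_iff.mpr hv0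
    have hu : ‖‖v‖⁻¹ • v‖ = 1 := by
      rw [norm_smul, norm_inv, norm_norm, inv_mul_cancel₀ hvn]
    have huθ : inner ℝ (‖v‖⁻¹ • v) θ = 0 := by
      rw [real_inner_smul_left, hv, mul_zero]
    have h := key _ hu huθ
    rw [map_smul] at h
    have h2 := congrArg (fun w => ‖v‖ • w) h
    simp only [smul_smul, mul_inv_cancel₀ hvn, one_smul] at h2
    exact h2
  intro u hu huθ
  have hθu : inner ℝ θ u = 0 := by rw [real_inner_comm]; exact huθ
  -- the great circle through `θ` with velocity `u`
  set γ : ℝ → E4 := fun t => Real.cos t • θ + Real.sin t • u with hγ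
  have hγ_sphere : ∀ t, ‖γ t‖ = 1 := by
    intro t
    have h1 : ‖γ t‖ ^ 2 = 1 := by
      rw [← real_inner_self_eq_norm_sq]
      simp only [hγ, inner_add_left, inner_add_right, real_inner_smul_left,
        real_inner_smul_right, hθu, huθ, mul_zero, add_zero, zero_add]
      simp only [real_inner_self_eq_norm_sq, hθ, hu, one_pow, mul_one]
      nlinarith [Real.cos_sq_add_sin_sq t]
    exact (pow_eq_one_iff_of_nonneg (norm_nonneg _) two_ne_zero).mp h1
  have hγ0 : γ 0 = θ := by simp [hγ]
  have hγ' : HasDerivAt γ u 0 := by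
    refine (((Real.hasDerivAt_cos 0).smul_const θ).add
      ((Real.hasDerivAt_sin 0).smul_const u)).congr_deriv ?_
    simp
  -- `κ ∘ γ = γ`, so both `dκ(θ) u` and `u` are derivatives of `γ` at `0`
  have hcomp : κ ∘ γ = γ := funext fun t => hsphere _ (hγ_sphere t)
  have h1 : HasDerivAt (κ ∘ γ) (fderiv ℝ κ θ u) 0 :=
    hdiff.hasFDerivAt.comp_hasDerivAt_of_eq 0 hγ' hγ0.symm
  rw [hcomp] at h1
  exact h1.unique hγ'

/-- The radial component of the differential at the sphere of a shell map fixing the sphere and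
preserving the inner side is nonnegative: `0 ≤ ⟨dκ(θ) θ, θ⟩` (the function `r ↦ ‖κ (r • θ)‖²`
is `< 1` just left of `1` and `= 1` at `1`). [folklore] -/
theorem collarFirstOrder_radial_nonneg {κ : E4 → E4} {δ₁ : ℝ} (hδ₁ : 0 < δ₁) (hδ₁1 : δ₁ < 1)
    (hsphere : ∀ y : E4, ‖y‖ = 1 → κ y = y)
    (hside : ∀ y : E4, |‖y‖ - 1| < δ₁ → (‖y‖ < 1 ↔ ‖κ y‖ < 1))
    {θ : E4} (hθ : ‖θ‖ = 1) (hdiff : DifferentiableAt ℝ κ θ) :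
    0 ≤ inner ℝ (fderiv ℝ κ θ θ) θ := by
  -- `f r := ‖κ (r • θ)‖ ^ 2` has derivative `2 ⟨θ, dκ(θ) θ⟩` at `1`
  set f : ℝ → ℝ := fun r => ‖κ (r • θ)‖ ^ 2 with hf
  have hp : HasDerivAt (fun r : ℝ => r • θ) θ 1 := by
    simpa using (hasDerivAt_id (1 : ℝ)).smul_const θ
  have hκp : HasDerivAt (fun r : ℝ => κ (r • θ)) (fderiv ℝ κ θ θ) 1 :=
    hdiff.hasFDerivAt.comp_hasDerivAt_of_eq 1 hp (by simp)
  have hf' : HasDerivAt f (2 * inner ℝ θ (fderiv ℝ κ θ θ)) 1 := by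
    have := hκp.norm_sq
    simp only [one_smul, hsphere θ hθ] at this
    exact this
  have hf1 : f 1 = 1 := by simp [hf, hsphere θ hθ, hθ]
  -- the slope from the left is nonnegative, hence so is the derivative
  have hlim := hf'.tendsto_slope_zero_left
  have hev : ∀ᶠ t in 𝓝[<] (0 : ℝ), (0 : ℝ) ≤ t⁻¹ • (f (1 + t) - f 1) := by
    have h1 : ∀ᶠ t in 𝓝[<] (0 : ℝ), t < 0 := self_mem_nhdsWithin
    have h2 : ∀ᶠ t in 𝓝[<] (0 : ℝ), -δ₁ < t :=
      mem_nhdsWithin_of_mem_nhds (Ioi_mem_nhds (by linarith))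
    filter_upwards [h1, h2] with t ht1 ht2
    have hnorm : ‖(1 + t) • θ‖ = 1 + t :=
      collarFirstOrder_norm_radial_smul hθ (by rw [add_sub_cancel_left, abs_lt]; constructor <;> linarith)
    have hshell : |‖(1 + t) • θ‖ - 1| < δ₁ := by
      rw [hnorm, abs_lt]; constructor <;> linarith
    have hlt : ‖κ ((1 + t) • θ)‖ < 1 := (hside _ hshell).mp (by rw [hnorm]; linarith)
    have hft : f (1 + t) < 1 := by
      have h0 := norm_nonneg (κ ((1 + t) • θ))
      simp only [hf]
      nlinarith
    rw [smul_eq_mul, hf1]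
    exact mul_nonneg_of_nonpos_of_nonpos (inv_nonpos.mpr ht1.le) (by linarith)
  have h0 : (0 : ℝ) ≤ 2 * inner ℝ θ (fderiv ℝ κ θ θ) := ge_of_tendsto hlim hev
  rw [real_inner_comm]
  linarith

/-- Strict positivity of the radial stretch, `0 < ⟨dκ(θ) θ, θ⟩`, when moreover `dκ(θ)` is
injective: if it vanished, `w = dκ(θ) θ ⊥ θ` would be fixed by `dκ(θ)`, whence
`dκ(θ) (θ - w) = 0` with `θ - w ≠ 0`. [folklore] -/
theorem collarFirstOrder_radial_pos {κ : E4 → E4} {δ₁ : ℝ} (hδ₁ : 0 < δ₁) (hδ₁1 : δ₁ < 1)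
    (hsphere : ∀ y : E4, ‖y‖ = 1 → κ y = y)
    (hside : ∀ y : E4, |‖y‖ - 1| < δ₁ → (‖y‖ < 1 ↔ ‖κ y‖ < 1))
    {θ : E4} (hθ : ‖θ‖ = 1) (hdiff : DifferentiableAt ℝ κ θ)
    (hinj : Injective (fderiv ℝ κ θ)) :
    0 < inner ℝ (fderiv ℝ κ θ θ) θ := by
  have h0 := collarFirstOrder_radial_nonneg hδ₁ hδ₁1 hsphere hside hθ hdiff
  rcases h0.lt_or_eq with h | h
  · exact h
  exfalso
  set L := fderiv ℝ κ θ with hL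
  have hw : L (L θ) = L θ :=
    collarFirstOrder_fderiv_apply_of_orthogonal hsphere hθ hdiff h.symm
  have hker : L (θ - L θ) = L 0 := by rw [map_sub, hw, sub_self, map_zero]
  have hθeq : θ - L θ = 0 := hinj hker
  have h1 : inner ℝ (θ - L θ) θ = 1 := by
    rw [inner_sub_left, ← h, sub_zero, real_inner_self_eq_norm_sq, hθ, one_pow]
  rw [hθeq, inner_zero_left] at h1
  exact zero_ne_one h1

/-- The spherical shell `{y | |‖y‖ - 1| < δ}` is open. [folklore] -/
theorem collarFirstOrder_isOpen_shell (δ : ℝ) : IsOpen {y : E4 | |‖y‖ - 1| < δ} :=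
  isOpen_lt (continuous_norm.sub continuous_const).abs continuous_const

/-- `dκ` is continuous on the open shell on which `κ` is `C^∞`. [folklore] -/
theorem collarFirstOrder_continuousOn_fderiv {κ : E4 → E4} {δ₁ : ℝ}
    (hκ : ∀ y : E4, |‖y‖ - 1| < δ₁ → ContDiffAt ℝ ∞ κ y) :
    ContinuousOn (fderiv ℝ κ) {y : E4 | |‖y‖ - 1| < δ₁} := by
  have hcd : ContDiffOn ℝ ∞ κ {y : E4 | |‖y‖ - 1| < δ₁} :=
    fun y hy => (hκ y hy).contDiffWithinAt
  exact hcd.continuousOn_fderiv_of_isOpen (collarFirstOrder_isOpen_shell δ₁) (by simp)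

/-- Uniform bounds on the unit sphere: a positive lower bound `m` for the radial stretch and an
operator-norm bound `W` for the differential (compactness of `S³`). [folklore] -/
theorem collarFirstOrder_sphere_bounds {κ : E4 → E4} {δ₁ : ℝ} (hδ₁ : 0 < δ₁) (hδ₁1 : δ₁ < 1)
    (hκ : ∀ y : E4, |‖y‖ - 1| < δ₁ → ContDiffAt ℝ ∞ κ y ∧ Injective (fderiv ℝ κ y))
    (hsphere : ∀ y : E4, ‖y‖ = 1 → κ y = y)
    (hside : ∀ y : E4, |‖y‖ - 1| < δ₁ → (‖y‖ < 1 ↔ ‖κ y‖ < 1)) :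
    ∃ m W : ℝ, 0 < m ∧ 0 ≤ W ∧ ∀ θ : E4, ‖θ‖ = 1 →
      m ≤ inner ℝ (fderiv ℝ κ θ θ) θ ∧ ‖fderiv ℝ κ θ‖ ≤ W := by
  have hS : IsCompact (Metric.sphere (0 : E4) 1) := isCompact_sphere 0 1
  have hsub : Metric.sphere (0 : E4) 1 ⊆ {y : E4 | |‖y‖ - 1| < δ₁} := by
    intro y hy
    rw [mem_sphere_zero_iff_norm] at hy
    simp [hy, hδ₁]
  have hcont : ContinuousOn (fderiv ℝ κ) (Metric.sphere (0 : E4) 1) :=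
    (collarFirstOrder_continuousOn_fderiv fun y hy => (hκ y hy).1).mono hsub
  have hg : ContinuousOn (fun θ : E4 => inner ℝ (fderiv ℝ κ θ θ) θ) (Metric.sphere (0 : E4) 1) :=
    (hcont.clm_apply continuousOn_id).inner continuousOn_id
  have hpos : ∀ θ ∈ Metric.sphere (0 : E4) 1, (0 : ℝ) < inner ℝ (fderiv ℝ κ θ θ) θ := by
    intro θ hθ
    rw [mem_sphere_zero_iff_norm] at hθ
    have hθshell : |‖θ‖ - 1| < δ₁ := by simp [hθ, hδ₁]
    exact collarFirstOrder_radial_pos hδ₁ hδ₁1 hsphere hside hθ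
      ((hκ θ hθshell).1.differentiableAt (by simp)) (hκ θ hθshell).2
  obtain ⟨m, hm, hmle⟩ := hS.exists_forall_le' hg hpos
  obtain ⟨C, hC⟩ := hS.exists_bound_of_continuousOn hcont
  refine ⟨m, max C 0, hm, le_max_right _ _, fun θ hθ => ⟨hmle θ ?_, (hC θ ?_).trans (le_max_left _ _)⟩⟩
    <;> simpa using hθ

/-- Uniform continuity of `dκ` across the sphere along radial segments (Heine–Cantor on the
compact shell `{y | |‖y‖ - 1| ≤ δ₁ / 2}`). [folklore] -/
theorem collarFirstOrder_fderiv_radial_uniform {κ : E4 → E4} {δ₁ : ℝ} (hδ₁ : 0 < δ₁)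
    (hδ₁1 : δ₁ < 1) (hκ : ∀ y : E4, |‖y‖ - 1| < δ₁ → ContDiffAt ℝ ∞ κ y) {ε : ℝ} (hε : 0 < ε) :
    ∃ δ : ℝ, 0 < δ ∧ δ < δ₁ ∧ ∀ θ : E4, ‖θ‖ = 1 → ∀ r : ℝ, |r - 1| < δ →
      ‖fderiv ℝ κ (r • θ) - fderiv ℝ κ θ‖ < ε := by
  set K : Set E4 := {y | |‖y‖ - 1| ≤ δ₁ / 2} with hK
  have hKc : IsCompact K := by
    refine Metric.isCompact_of_isClosed_isBounded ?_ ?_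
    · exact isClosed_le (continuous_norm.sub continuous_const).abs continuous_const
    · refine (Metric.isBounded_closedBall (x := (0 : E4)) (r := 2)).subset ?_
      intro y hy
      simp only [hK, mem_setOf_eq] at hy
      rw [Metric.mem_closedBall, dist_zero_right]
      have := (abs_le.mp hy).2
      linarith
  have hKsub : K ⊆ {y : E4 | |‖y‖ - 1| < δ₁} := fun y hy => by
    simp only [hK, mem_setOf_eq] at hy ⊢
    linarith
  have hcont : ContinuousOn (fderiv ℝ κ) K := (collarFirstOrder_continuousOn_fderiv hκ).mono hKsub
  have huc := hKc.uniformContinuousOn_of_continuous hcont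
  rw [Metric.uniformContinuousOn_iff] at huc
  obtain ⟨δ', hδ', h⟩ := huc ε hε
  refine ⟨min δ' (δ₁ / 2), lt_min hδ' (by linarith), (min_le_right _ _).trans_lt (by linarith),
    ?_⟩
  intro θ hθ r hr
  have hr' : |r - 1| < δ' := hr.trans_le (min_le_left _ _)
  have hr2 : |r - 1| < δ₁ / 2 := hr.trans_le (min_le_right _ _)
  have hnorm : ‖r • θ‖ = r := collarFirstOrder_norm_radial_smul hθ (by linarith)
  have hrK : r • θ ∈ K := by
    simp only [hK, mem_setOf_eq, hnorm]
    exact hr2.le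
  have hθK : θ ∈ K := by
    simp only [hK, mem_setOf_eq, hθ, sub_self, abs_zero]
    linarith
  have hdist : dist (r • θ) θ < δ' := by
    rw [dist_eq_norm, show r • θ - θ = (r - 1) • θ by rw [sub_smul, one_smul], norm_smul, hθ,
      mul_one, Real.norm_eq_abs]
    exact hr'
  have := h (r • θ) hrK θ hθK hdist
  rwa [dist_eq_norm] at this

/-- First-order Taylor remainder along a radial segment from a uniform bound on the oscillation of
the differential (mean value inequality on the segment). [folklore] -/
theorem collarFirstOrder_radial_remainder {κ : E4 → E4} {δ₁ δ ε : ℝ} (hδ : 0 < δ)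
    (hδδ₁ : δ < δ₁) (hδ₁1 : δ₁ < 1)
    (hκ : ∀ y : E4, |‖y‖ - 1| < δ₁ → ContDiffAt ℝ ∞ κ y)
    (hsphere : ∀ y : E4, ‖y‖ = 1 → κ y = y) {θ : E4} (hθ : ‖θ‖ = 1)
    (hosc : ∀ s : ℝ, |s - 1| < δ → ‖fderiv ℝ κ (s • θ) - fderiv ℝ κ θ‖ ≤ ε)
    {r : ℝ} (hr : |r - 1| < δ) :
    ‖κ (r • θ) - r • θ - (r - 1) • (fderiv ℝ κ θ θ - θ)‖ ≤ ε * |r - 1| := by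
  set L := fderiv ℝ κ θ with hL
  set G : ℝ → E4 := fun s => κ (s • θ) - s • θ - (s - 1) • (L θ - θ) with hG
  have hG1 : G 1 = 0 := by simp [hG, hsphere θ hθ]
  have hderiv : ∀ s ∈ Metric.ball (1 : ℝ) δ,
      HasDerivWithinAt G ((fderiv ℝ κ (s • θ) - L) θ) (Metric.ball (1 : ℝ) δ) s := by
    intro s hs
    rw [Metric.mem_ball, Real.dist_eq] at hs
    have hnorm : ‖s • θ‖ = s := collarFirstOrder_norm_radial_smul hθ (by linarith)
    have hshell : |‖s • θ‖ - 1| < δ₁ := by rw [hnorm]; linarith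
    have hd : DifferentiableAt ℝ κ (s • θ) := (hκ _ hshell).differentiableAt (by simp)
    have hp : HasDerivAt (fun s : ℝ => s • θ) θ s := by
      simpa using (hasDerivAt_id s).smul_const θ
    have h1 : HasDerivAt (fun s : ℝ => κ (s • θ)) (fderiv ℝ κ (s • θ) θ) s :=
      hd.hasFDerivAt.comp_hasDerivAt_of_eq s hp rfl
    have h3 : HasDerivAt (fun s : ℝ => (s - 1) • (L θ - θ)) (L θ - θ) s := by
      simpa using ((hasDerivAt_id s).sub_const 1).smul_const (L θ - θ)
    have h : HasDerivAt G ((fderiv ℝ κ (s • θ) - L) θ) s :=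
      ((h1.sub hp).sub h3).congr_deriv (by simp only [sub_apply]; abel)
    exact h.hasDerivWithinAt
  have hbound : ∀ s ∈ Metric.ball (1 : ℝ) δ, ‖(fderiv ℝ κ (s • θ) - L) θ‖ ≤ ε := by
    intro s hs
    rw [Metric.mem_ball, Real.dist_eq] at hs
    calc ‖(fderiv ℝ κ (s • θ) - L) θ‖ ≤ ‖fderiv ℝ κ (s • θ) - L‖ * ‖θ‖ :=
          ContinuousLinearMap.le_opNorm _ _
      _ ≤ ε * 1 := by rw [hθ]; exact mul_le_mul_of_nonneg_right (hosc s hs) zero_le_one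
      _ = ε := mul_one ε
  have hmv := (convex_ball (1 : ℝ) δ).norm_image_sub_le_of_norm_hasDerivWithin_le hderiv hbound
    (Metric.mem_ball_self hδ) (by rwa [Metric.mem_ball, Real.dist_eq])
  rw [hG1, sub_zero, Real.norm_eq_abs] at hmv
  simpa only [hG] using hmv

/-- **Helper D1 (first-order data of a collar map at the unit sphere).**  Let `κ : ℝ⁴ → ℝ⁴` be
`C^∞` with injective differential on the shell `|‖y‖ - 1| < δ₁` (`0 < δ₁ < 1`), equal to the
identity on the unit sphere, and mapping the inner side to the inner side
(`‖y‖ < 1 ↔ ‖κ y‖ < 1` on the shell).  Then there are `m > 0` and `W ≥ 0` such that for every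
unit vector `θ`: `m ≤ ⟨dκ(θ) θ, θ⟩`, `‖dκ(θ)‖ ≤ W`, and `dκ(θ) v = v` for `v ⊥ θ`; and for every
`ε > 0` there is `δ ∈ (0, δ₁)` with `‖dκ(r • θ) - dκ(θ)‖ ≤ ε` and
`‖κ (r • θ) - r • θ - (r - 1) • (dκ(θ) θ - θ)‖ ≤ ε |r - 1|` whenever `‖θ‖ = 1` and
`|r - 1| < δ`. [folklore] -/
theorem helper_collarFirstOrder :
    ∀ (κ : E4 → E4) (δ₁ : ℝ), 0 < δ₁ → δ₁ < 1 →
      (∀ y : E4, |‖y‖ - 1| < δ₁ → ContDiffAt ℝ ∞ κ y ∧ Injective (fderiv ℝ κ y)) →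
      (∀ y : E4, ‖y‖ = 1 → κ y = y) →
      (∀ y : E4, |‖y‖ - 1| < δ₁ → (‖y‖ < 1 ↔ ‖κ y‖ < 1)) →
      ∃ m W : ℝ, 0 < m ∧ 0 ≤ W ∧
        (∀ θ : E4, ‖θ‖ = 1 →
          m ≤ inner ℝ (fderiv ℝ κ θ θ) θ ∧ ‖fderiv ℝ κ θ‖ ≤ W ∧
          ∀ v : E4, inner ℝ v θ = 0 → fderiv ℝ κ θ v = v) ∧
        ∀ ε : ℝ, 0 < ε → ∃ δ : ℝ, 0 < δ ∧ δ < δ₁ ∧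
          ∀ θ : E4, ‖θ‖ = 1 → ∀ r : ℝ, |r - 1| < δ →
            ‖fderiv ℝ κ (r • θ) - fderiv ℝ κ θ‖ ≤ ε ∧
            ‖κ (r • θ) - r • θ - (r - 1) • (fderiv ℝ κ θ θ - θ)‖ ≤ ε * |r - 1| := by
  intro κ δ₁ hδ₁ hδ₁1 hκ hsphere hside
  obtain ⟨m, W, hm, hW, hmW⟩ := collarFirstOrder_sphere_bounds hδ₁ hδ₁1 hκ hsphere hside
  refine ⟨m, W, hm, hW, fun θ hθ => ⟨(hmW θ hθ).1, (hmW θ hθ).2, fun v hv => ?_⟩,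
    fun ε hε => ?_⟩
  · have hθshell : |‖θ‖ - 1| < δ₁ := by simp [hθ, hδ₁]
    exact collarFirstOrder_fderiv_apply_of_orthogonal hsphere hθ
      ((hκ θ hθshell).1.differentiableAt (by simp)) hv
  · obtain ⟨δ, hδ, hδδ₁, hosc⟩ :=
      collarFirstOrder_fderiv_radial_uniform hδ₁ hδ₁1 (fun y hy => (hκ y hy).1) hε
    refine ⟨δ, hδ, hδδ₁, fun θ hθ r hr => ⟨(hosc θ hθ r hr).le, ?_⟩⟩
    exact collarFirstOrder_radial_remainder hδ hδδ₁ hδ₁1 (fun y hy => (hκ y hy).1) hsphere hθ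
      (fun s hs => (hosc θ hθ s hs).le) hr

end Summit.SmoothPoincare4.SmoothPoincare4.Theorems.Target.KaehlerJacket

end
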